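import Summits.CriticalPhenomena.PercolationContinuityZ3.Theorems.Transplant.CayleySkeletonFrm
import Summits.CriticalPhenomena.PercolationContinuityZ3.Theorems.Transplant.CayleyNegCustomersHolds
import HarnessLib

/-!
# Cores and supersets: a connected unit cylinder for a SUB-alphabet gives one for every unit-range super-alphabet — unconditional `{±1}` rows with
# extra diagonal / doubled generators over a letters-type core

builds on p205010 (kernel theorem, internal audit signed; external expert review pending) — through the closed one-type `{±1}` node
(`CayleyNeg₂.theta_eq_zero_of_le`, file `CayleyNegCustomersHolds`).  Lane `prim-bschramm`, seat `prim-bschramm-p4` gen 13 (PART C3 of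
`P4-GENERAL.md` §35.7/§35.10).  Helper file (`--supports stmt-CriticalPhenomena-4575 --as helper`).

MONOTONICITY (P4-GENERAL §35.1): at a fixed chart `φ`, the unit cylinder `{‖φ‖_∞ ≤ 1}` of `Cay(Γ; S')` contains that of `Cay(Γ; S)` as a spanning
subgraph whenever `S ⊆ S'`, so `C_1(S)` connected ⟹ `C_1(S')` connected.  Hence every connected-cylinder criterion for a CORE `S` (kernel letters,
class ≤ 3 letters-type, class ≤ 2, abelian) serves every super-alphabet `S' ⊇ S` of unit range — the reversing automorphism need only preserve `S'`,
not the core: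
* `CayleyNeg₂.ofCore (C : CayleyFrm₂ Γ S) (S ⊆ S') (‖φ(S')‖_∞ ≤ 1) (ν preserving S', φν = −φ) : CayleyNeg₂ Γ S'` and
  **`theta_eq_zero_of_le_core`** (UNCONDITIONAL): θ_g(p) = 0 ∀ p ≤ p_c on `Cay(Γ; S')`;
* **`theta_eq_zero_of_le_classThree_core`** (UNCONDITIONAL): Γ of class ≤ 3, a letters-type symmetric generating core `S` (each letter in
  `ker φ ∪ {s₀^{±1}, s₁^{±1}}`), any `S' ⊇ S` with `‖φ(S')‖_∞ ≤ 1` and ONE `S'`-preserving φ-reversing automorphism — e.g.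
  `Cay(N_{2,3}; a, b, ab, ba)`, `Cay(N_{m,3}/K; letters ∪ {products of two letters})` with the letter inversion (`ν(ab) = (ba)⁻¹`): gen 11/12's class-3
  rows (`NilThreeNeg.NegData`) were letters-only.
[cite: BenjaminiSchramm1996, Conj. 4; §2 (Cayley graphs)] [cite: KozmaNitzan2024, §4 p. 16 (Lemma 8)]
-/

noncomputable section

namespace Summit.CriticalPhenomena.PercolationContinuityZ3.Theorems.Transplant

open SimpleGraph Walk Literature.Probability.LatticeModels Literature.Probability.Percolation
open scoped Classical

variable {Γ : Type} [Group Γ] {S S' : Finset Γ}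

/-- **`CayleyNeg₂` ON A SUPER-ALPHABET FROM A CORE**: a `CayleyFrm₂` on `S ⊆ S'` (connected unit cylinder of the core), unit range of the same chart
on `S'`, and ONE automorphism preserving `S'` and reversing the chart. [cite: KozmaNitzan2024, §4 p. 16 (Lemma 8)] -/
def CayleyNeg₂.ofCore (C : CayleyFrm₂ Γ S) (hsub : S ⊆ S') (lip' : ∀ s ∈ S', ∀ i : Fin 2, |C.φ s i| ≤ 1) (ν : Γ ≃* Γ)
    (ν_mem : ∀ s, ν s ∈ S' ↔ s ∈ S') (ν_φ : ∀ g, C.φ (ν g) = -C.φ g) : CayleyNeg₂ Γ S' where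
  φ := C.φ
  map_mul := C.map_mul
  lip := lip'
  step := fun i => by obtain ⟨s, hs, h⟩ := C.step i; exact ⟨s, hsub hs, h⟩
  ν := ν
  ν_mem := ν_mem
  ν_φ := ν_φ
  cyl_one := by
    have hle : (mulCayley (S : Set Γ)).induce {g | C.φ g ∈ box 2 1} ≤ (mulCayley (S' : Set Γ)).induce {g | C.φ g ∈ box 2 1} :=
      fun _ _ h => mulCayley_mono (Finset.coe_subset.2 hsub) h
    exact C.cyl_one.mono hle

/-- **THEOREM (UNCONDITIONAL; core + unit-range extras): `θ_g(p) = 0` for every `p ≤ p_c` at every vertex of `Cay(Γ; S')`** whenever a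
sub-alphabet `S ⊆ S'` carries a `CayleyFrm₂` (connected unit cylinder), the chart has unit range on `S'`, and ONE automorphism preserves `S'` and
reverses the chart. builds on p205010 (kernel theorem, internal audit signed; external expert review pending). [cite: BenjaminiSchramm1996, Conj. 4; §2] -/
theorem theta_eq_zero_of_le_core (C : CayleyFrm₂ Γ S) (hsub : S ⊆ S') (lip' : ∀ s ∈ S', ∀ i : Fin 2, |C.φ s i| ≤ 1) (ν : Γ ≃* Γ)
    (ν_mem : ∀ s, ν s ∈ S' ↔ s ∈ S') (ν_φ : ∀ g, C.φ (ν g) = -C.φ g) (g : Γ) {p : unitInterval}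
    (hp : (p : ℝ) ≤ criticalProb (mulCayley (↑S' : Set Γ)) g) : theta (mulCayley (↑S' : Set Γ)) g p = 0 :=
  (CayleyNeg₂.ofCore C hsub lip' ν ν_mem ν_φ).theta_eq_zero_of_le g hp

/-- **THEOREM (UNCONDITIONAL; class ≤ 3, letters-type core + unit-range extras): `θ_g(p) = 0` for every `p ≤ p_c` on `Cay(Γ; S')`** for every
group of class `≤ 3`, every letters-type symmetric generating core `S ⊆ S'` (each letter in `ker φ ∪ {s₀^{±1}, s₁^{±1}}`), `‖φ(S')‖_∞ ≤ 1`, and ONE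
`S'`-preserving φ-reversing automorphism — e.g. `Cay(N_{2,3}; a, b, ab, ba)` with the letter inversion.
builds on p205010 (kernel theorem, internal audit signed; external expert review pending). [cite: BenjaminiSchramm1996, Conj. 4; §2] -/
theorem theta_eq_zero_of_le_classThree_core (B : CayCyl.CylBase Γ S) (h3 : (⊤ : Subgroup Γ).lowerCentralSeries 3 = ⊥)
    (hS : Subgroup.closure (S : Set Γ) = ⊤) (hsymm : ∀ s ∈ S, s⁻¹ ∈ S)
    (hSφ : ∀ s ∈ S, B.φ s = 0 ∨ s = B.s₀ ∨ s = B.s₀⁻¹ ∨ s = B.s₁ ∨ s = B.s₁⁻¹) (hsub : S ⊆ S')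
    (lip' : ∀ s ∈ S', ∀ i : Fin 2, |B.φ s i| ≤ 1) (ν : Γ ≃* Γ) (ν_mem : ∀ s, ν s ∈ S' ↔ s ∈ S') (ν_φ : ∀ g, B.φ (ν g) = -B.φ g)
    (g : Γ) {p : unitInterval} (hp : (p : ℝ) ≤ criticalProb (mulCayley (↑S' : Set Γ)) g) : theta (mulCayley (↑S' : Set Γ)) g p = 0 :=
  theta_eq_zero_of_le_core (CayleyFrm₂.ofClassThree B h3 hS hsymm hSφ) hsub lip' ν ν_mem ν_φ g hp

/-- **CONDITIONAL twin (no automorphism, modulo N2)**: a core `CayleyFrm₂` on `S ⊆ S'` and unit range on `S'` give `θ_g(p) = 0 ∀ p ≤ p_c` on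
`Cay(Γ; S')` modulo the frames-only node. [cite: BenjaminiSchramm1996, Conj. 4; §2] -/
theorem theta_eq_zero_of_le_core_of_frmNode₁ (hN : SamePDropOfSkeletonFrm₁) (C : CayleyFrm₂ Γ S) (hsub : S ⊆ S')
    (lip' : ∀ s ∈ S', ∀ i : Fin 2, |C.φ s i| ≤ 1) (g : Γ) {p : unitInterval}
    (hp : (p : ℝ) ≤ criticalProb (mulCayley (↑S' : Set Γ)) g) : theta (mulCayley (↑S' : Set Γ)) g p = 0 :=
  CayleyFrm₂.theta_eq_zero_of_le_of_frmNode₁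
    { φ := C.φ, map_mul := C.map_mul, lip := lip', step := fun i => by obtain ⟨s, hs, h⟩ := C.step i; exact ⟨s, hsub hs, h⟩
      cyl_one := by
        have hle : (mulCayley (S : Set Γ)).induce {g | C.φ g ∈ box 2 1} ≤ (mulCayley (S' : Set Γ)).induce {g | C.φ g ∈ box 2 1} :=
          fun _ _ h => mulCayley_mono (Finset.coe_subset.2 hsub) h
        exact C.cyl_one.mono hle } hN g hp

end Summit.CriticalPhenomena.PercolationContinuityZ3.Theorems.Transplant

end
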